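import Summits.FinalStateConjecture.FinalStateConjecture.Theorems.ZeroEnergyKerrOrBombOneLockedExplosionDefs
import Literature.Geometry.Lorentzian.KerrWaveDecay
import HarnessLib

/-!
# Route ZeroEnergyKerrOrBomb · crux `StationaryLimitReduction` (stmt-FinalStateConjecture-10021), line
# `symplectic-dual-of-the-bomb` — bookkeeping kit for the chart transfer `stub_chartTransfer`

Helper file (`--supports stmt-FinalStateConjecture-10021`; registered helpers
`chartTransfer_of_N_eq_zero`, `reach_of_hasExhaustiveCharts`, `excision_transfer`) from the lead's
wave-1 stub-worker for `stub_chartTransfer` (lead prover-line-stmt-FinalStateConjecture-10021-a1-0,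
2026-08-16). The stub asks to turn a `C²` STATIONARY final-state decomposition
(`StationaryFinalStateDecomposition`, adapted charts of abstract stationary holes, possibly with a collar
behind `𝓗⁺`) whose holes are `T`-equivariantly Kerr-charted into the summit's Kerr–Schild
`FinalStateDecomposition` with `O' = exteriorOf 𝒟 d'.charted` and `HasExhaustiveCharts d'`. This file
lands the CLOSED, chart-free pieces of that transfer:

* §1 `chartTransfer_of_N_eq_zero` — the case of no hole (`d.N = 0`) IS the tree's chart-level transfer
  `StationaryFinalStateDecomposition.toFinalStateDecomposition` (vacuous `IsKerr`), with the same `O`.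
* §2 `exists_forall_not_mem_certifiedLate`, `eventually_mem_causalPast_certifiedSlab`,
  `reach_of_hasExhaustiveCharts` — a consequence of the exhaustiveness clause (ii) of
  `FinalStateDecompositionOver.HasExhaustiveCharts` that every transfer argument (and every audit of the
  clause) uses: since the late charts are injective on their late regions, a point of `O` has at most one
  preimage time per chart, so it leaves every certified late region, hence lies in the causal past of the
  certified slab at EVERY sufficiently late chart time. (Read contrapositively: a point of `O` whose causal
  future reaches only boundedly late certified slabs — e.g. a point of a chart image strictly behind a
  non-degenerate horizon collar, red-shift — violates (ii); recorded in the worker's report.)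
* §3 `mem_chronologicalFuture_of_isOpen` / `mem_chronologicalPast_of_isOpen` (a point of `I⁺(S)` lies in
  `I⁺(U)` for every open `U ∋` it: restrict the witnessing curve to a final segment), and the resulting
  monotonicity / localisation of the summit's `exteriorOf`: `exteriorOf_mono`,
  `subset_exteriorOf_of_isOpen` — an OPEN subset of `exteriorOf 𝒟 U` contained in `U'` lies in
  `exteriorOf 𝒟 U'` (the formal content of the `image_subset` clause of re-adapted late charts).
* §4 `excision_transfer`: the flat-domain clause of a stationary decomposition, which excises the
  tubes `{A.radius ≤ ρᵢ(x⁰)}` of the adapted radii, implies the Kerr–Schild flat-domain clause with the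
  tubes `{Kerr.radius aᵢ ≤ ρᵢ(x⁰) + Cᵢ}`, still sublinear — for ANY spins `aᵢ` and any later `τ₀'`
  (`A.radius ≥ ‖y‖ − Cᵢ ≥ Kerr.radius aᵢ − Cᵢ` in the rest frame).

Elementary; no named fact, nothing restated. References: Dafermos–Luk arXiv:1710.01722, Conjecture 1
(b)–(c); O'Neill 1983, Ch. 14, pp. 402–403.
-/

set_option linter.dupNamespace false

noncomputable section

open scoped Manifold ContDiff Topology ENNReal
open Set Filter Function Literature.Geometry.Lorentzian

namespace Summit.FinalStateConjecture.FinalStateConjecture.Theorems.SymplecticDualOfTheBomb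

/-! ## §1 Sanity: the case of no hole -/

/-- **Registered helper `chartTransfer_of_N_eq_zero`.** With no hole (`d.N = 0`) the conclusion of
`stub_chartTransfer` holds with `O' = O`: the tree's chart-level transfer
`StationaryFinalStateDecomposition.toFinalStateDecomposition` applies with vacuous Kerr data, keeps the
charted region (`charted_toFinalStateDecomposition`) and exhaustiveness
(`hasExhaustiveCharts_toFinalStateDecomposition`, definitionally the summit's clause). [folklore] -/
theorem chartTransfer_of_N_eq_zero : ∀ (X : Type) [TopologicalSpace X] [ChartedSpace E3 X] [IsManifold (𝓡 3) ∞ X] [T2Space X] [SecondCountableTopology X] [ConnectedSpace X] (D : InitialDataSet (𝓡 3) X) (𝒟 : VacuumCauchyDevelopment D) (O : Set 𝒟.carrier) (d : StationaryFinalStateDecomposition 𝒟.toSpacetime O 2), d.N = 0 → O = Summit.FinalStateConjecture.exteriorOf 𝒟.toCauchyDevelopment d.charted → d.HasExhaustiveCharts → ∃ (O' : Set 𝒟.carrier) (d' : FinalStateDecomposition 𝒟.toSpacetime O' 2), (∀ i, Kerr.IsSubextremal (d'.mass i) (d'.spin i)) ∧ O' = Summit.FinalStateConjecture.exteriorOf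 𝒟.toCauchyDevelopment d'.charted ∧ Summit.FinalStateConjecture.HasExhaustiveCharts d' := by
  intro X _ _ _ _ _ _ D 𝒟 O d hN hO hex
  have hM : ∀ i : Fin d.N, False := fun i ↦ (Fin.cast hN i).elim0
  refine ⟨O, d.toFinalStateDecomposition (fun i ↦ (hM i).elim) (fun i ↦ (hM i).elim)
    (fun i ↦ (hM i).elim) (fun i ↦ (hM i).elim), fun i ↦ (hM i).elim, ?_, ?_⟩
  · rw [StationaryFinalStateDecomposition.charted_toFinalStateDecomposition]
    exact hO
  · -- buildfix 2026-08-20 (proof-only): since the audit-g6 re-type the summit's `HasExhaustiveCharts`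
    -- carries an extra radii clause `∀ i, Tendsto (R i) atTop atTop ∧ ∀ τ, max r₊ 0 + 1 ≤ R i τ`
    -- in front of the two clauses of `FinalStateDecompositionOver.HasExhaustiveCharts`; with no
    -- hole (`d.N = 0`) it is vacuous.
    obtain ⟨R, hconv, hcov⟩ := d.hasExhaustiveCharts_toFinalStateDecomposition _ _ _ _ hex
    exact ⟨R, fun i ↦ (hM i).elim, hconv, hcov⟩

/-! ## §2 Exhaustiveness (ii) puts every point of `O` in the causal past of every late certified slab -/

section Reach

variable {𝓢 : Spacetime.{0} 4} {O : Set 𝓢.carrier} {k N : ℕ} {B : Fin N → ModelBackground}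

/-- A map injective on the late region `{τ₀ < time}` hits a given point `p` at most once there, so
from some `T ≥ τ₀` on, `p` is not the image of any point later than `T`. [folklore] -/
theorem exists_forall_ne_of_injOn {α β : Type*} (time : α → ℝ) (f : α → β) (τ₀ : ℝ)
    (hinj : InjOn f {x | τ₀ < time x}) (p : β) :
    ∃ T : ℝ, τ₀ ≤ T ∧ ∀ τ₁, T ≤ τ₁ → ∀ x, τ₁ < time x → f x ≠ p := by
  by_cases h : ∃ x, τ₀ < time x ∧ f x = p
  · obtain ⟨x₀, hx₀, hfx₀⟩ := h
    refine ⟨max τ₀ (time x₀), le_max_left _ _, fun τ₁ hτ₁ x hx hfx ↦ ?_⟩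
    have hx' : τ₀ < time x := lt_of_le_of_lt ((le_max_left _ _).trans hτ₁) hx
    have heq : x = x₀ := hinj hx' hx₀ (hfx.trans hfx₀.symm)
    subst heq
    exact absurd ((le_max_right _ _).trans hτ₁) (not_le.2 hx)
  · push Not at h
    exact ⟨τ₀, le_rfl, fun τ₁ hτ₁ x hx hfx ↦ h x (lt_of_le_of_lt hτ₁ hx) hfx⟩

/-- **A point has at most one late preimage time per chart**, hence leaves every certified late
region: `p ∉ certifiedLate R τ₁` for all `τ₁ ≥ T(p)` (injectivity of the late charts on their late
regions, `IsLateChart.isOpenEmbedding`). [folklore] -/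
theorem exists_forall_not_mem_certifiedLate (d : FinalStateDecompositionOver 𝓢 O k B)
    (R : Fin N → ℝ → ℝ) (p : 𝓢.carrier) :
    ∃ T : ℝ, d.τ₀ ≤ T ∧ ∀ τ₁, T ≤ τ₁ → p ∉ d.certifiedLate R τ₁ := by
  -- the flat chart
  obtain ⟨Tf, hTf₀, hTf⟩ := exists_forall_ne_of_injOn (fun z : d.flatDomain ↦ (z : E4) 0) d.flatChart
    d.τ₀ (injOn_iff_injective.2 d.isLateChart_flat.isOpenEmbedding.injective) p
  -- the hole charts
  have hh : ∀ i, ∃ T : ℝ, d.τ₀ ≤ T ∧ ∀ τ₁, T ≤ τ₁ → ∀ x : (B i).domain, τ₁ < (B i).time x.1 →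
      d.chart i x ≠ p := fun i ↦
    exists_forall_ne_of_injOn (fun x : (B i).domain ↦ (B i).time x.1) (d.chart i) d.τ₀
      (injOn_iff_injective.2 (d.isLateChart i).isOpenEmbedding.injective) p
  choose Th hTh₀ hTh using hh
  have hsum : ∀ i, Th i - d.τ₀ ≤ ∑ j, (Th j - d.τ₀) := fun i ↦
    Finset.single_le_sum (f := fun j ↦ Th j - d.τ₀) (fun j _ ↦ sub_nonneg.2 (hTh₀ j))
      (Finset.mem_univ i)
  have hsum₀ : 0 ≤ ∑ j, (Th j - d.τ₀) := Finset.sum_nonneg fun j _ ↦ sub_nonneg.2 (hTh₀ j)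
  refine ⟨Tf + ∑ j, (Th j - d.τ₀), hTf₀.trans (le_add_of_nonneg_right hsum₀), fun τ₁ hτ₁ hp ↦ ?_⟩
  have h1 : Tf ≤ τ₁ := (le_add_of_nonneg_right hsum₀).trans hτ₁
  have h2 : ∀ i, Th i ≤ τ₁ := fun i ↦ by linarith [hsum i]
  rcases hp with ⟨z, hz, hzp⟩ | hp
  · exact hTf τ₁ h1 z hz hzp
  · obtain ⟨i, hi⟩ := mem_iUnion.1 hp
    obtain ⟨x, hx, hxp⟩ := hi
    exact hTh i τ₁ (h2 i) x hx.1 hxp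

/-- **Exhaustiveness (ii) ⇒ every point of `O` lies in `J⁻` of the certified slab at every late
enough chart time.** If `O ∖ certifiedLate R τ₁ ⊆ J⁻(certifiedSlab R τ₁)` for every `τ₁ > τ₀`, then
for `p ∈ O`, eventually in `τ₁`, `p ∈ J⁻(certifiedSlab R τ₁)`. Dafermos–Luk arXiv:1710.01722,
Conjecture 1 (b)–(c) (the clause); the consequence is elementary. [folklore] -/
theorem eventually_mem_causalPast_certifiedSlab (d : FinalStateDecompositionOver 𝓢 O k B)
    {R : Fin N → ℝ → ℝ}
    (hcov : ∀ τ₁ : ℝ, d.τ₀ < τ₁ →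
      O \ d.certifiedLate R τ₁ ⊆ 𝓢.metric.causalPast 𝓢.timeOrientation (d.certifiedSlab R τ₁))
    {p : 𝓢.carrier} (hp : p ∈ O) :
    ∀ᶠ τ₁ in atTop, p ∈ 𝓢.metric.causalPast 𝓢.timeOrientation (d.certifiedSlab R τ₁) := by
  obtain ⟨T, hT₀, hT⟩ := exists_forall_not_mem_certifiedLate d R p
  filter_upwards [eventually_gt_atTop T] with τ₁ hτ₁
  exact hcov τ₁ (lt_of_le_of_lt hT₀ hτ₁) ⟨hp, hT τ₁ hτ₁.le⟩

/-- `HasExhaustiveCharts` form: the near-zone radii `R` of the clause serve every point of `O`.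
[folklore] -/
theorem exists_forall_eventually_mem_causalPast (d : FinalStateDecompositionOver 𝓢 O k B)
    (h : d.HasExhaustiveCharts) :
    ∃ R : Fin N → ℝ → ℝ,
      (∀ i, Tendsto (fun τ ↦ 𝓢.truncDeviationCk (B i) (d.chart i) k (R i τ) τ) atTop (𝓝 0)) ∧
      ∀ p ∈ O, ∀ᶠ τ₁ in atTop,
        p ∈ 𝓢.metric.causalPast 𝓢.timeOrientation (d.certifiedSlab R τ₁) := by
  obtain ⟨R, hR, hcov⟩ := h
  exact ⟨R, hR, fun p hp ↦ eventually_mem_causalPast_certifiedSlab d hcov hp⟩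

end Reach

/-- **Registered helper `reach_of_hasExhaustiveCharts`** (binder-free form, for the stationary
decompositions of `SettlesWith`): if the charts of `d` exhaust `O`, every point of `O` lies in the
causal past of the certified slab `flatChart({x⁰ = τ₁}) ∪ ⋃ᵢ chartᵢ({tᵢ = τ₁, rᵢ ≤ Rᵢ(τ₁)})` for all
sufficiently late `τ₁`. [folklore] -/
theorem reach_of_hasExhaustiveCharts : ∀ (𝓢 : Spacetime.{0} 4) (O : Set 𝓢.carrier) (k : ℕ) (d : StationaryFinalStateDecomposition 𝓢 O k), d.HasExhaustiveCharts → ∃ R : Fin d.N → ℝ → ℝ, ∀ p ∈ O, ∀ᶠ τ₁ in Filter.atTop, p ∈ 𝓢.metric.causalPast 𝓢.timeOrientation (d.toOver.certifiedSlab R τ₁) :=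
  fun _ _ _ d h ↦ by
    obtain ⟨R, -, hR⟩ := exists_forall_eventually_mem_causalPast d.toOver h
    exact ⟨R, hR⟩

/-- Summit form: for a Kerr–Schild `FinalStateDecomposition` with the summit's
`HasExhaustiveCharts`, every point of `O` lies in `J⁻` of the summit's certified slab at every late
enough chart time (the summit's clause is `d.toOver.HasExhaustiveCharts` definitionally). [folklore] -/
theorem eventually_mem_causalPast_certifiedSlab_summit {𝓢 : Spacetime.{0} 4} {O : Set 𝓢.carrier}
    {k : ℕ} (d : FinalStateDecomposition 𝓢 O k) (h : Summit.FinalStateConjecture.HasExhaustiveCharts d) :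
    ∃ R : Fin d.N → ℝ → ℝ, ∀ p ∈ O, ∀ᶠ τ₁ in atTop,
      p ∈ 𝓢.metric.causalPast 𝓢.timeOrientation (Summit.FinalStateConjecture.certifiedSlab d R τ₁) := by
  -- buildfix 2026-08-20 (proof-only): drop the summit's extra radii clause (audit-g6 re-type) to
  -- reach `d.toOver.HasExhaustiveCharts`.
  obtain ⟨R₀, -, hconv, hcov⟩ := h
  obtain ⟨R, -, hR⟩ := exists_forall_eventually_mem_causalPast d.toOver ⟨R₀, hconv, hcov⟩
  exact ⟨R, hR⟩

/-! ## §3 Chronological futures see every open neighbourhood; localisation of `exteriorOf` -/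

section Chronology

variable {E : Type*} [NormedAddCommGroup E] [NormedSpace ℝ E] {H : Type*} [TopologicalSpace H]
  {I : ModelWithCorners ℝ E H} {n : ℕ∞ω} {M : Type*} [TopologicalSpace M] [ChartedSpace H M]
  [IsManifold I ∞ M] {g : LorentzianMetric I n M} {τ : TimeOrientation g}

/-- **A point of `I⁺(S)` lies in `I⁺(U)` for every open `U` containing it**: the final segment
`γ|[s, b]` of a witnessing timelike curve, `s` close to `b`, starts inside `U` (continuity of `γ` at
`b`). O'Neill 1983, Ch. 14, pp. 402–403. [folklore] -/
theorem mem_chronologicalFuture_of_isOpen {S U : Set M} {q : M}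
    (hq : q ∈ g.chronologicalFuture τ S) (hU : IsOpen U) (hqU : q ∈ U) :
    q ∈ g.chronologicalFuture τ U := by
  obtain ⟨p, -, γ, a, b, hab, hγ, -, hγb⟩ := hq
  have hcont : ContinuousAt γ b := (hγ b (right_mem_Icc.2 hab.le)).1.continuousAt
  have hmem : ∀ᶠ s in 𝓝 b, γ s ∈ U := hcont.preimage_mem_nhds (hU.mem_nhds (hγb ▸ hqU))
  obtain ⟨δ, hδ, hball⟩ := Metric.eventually_nhds_iff.1 hmem
  have hsb : max a (b - δ / 2) < b := max_lt hab (by linarith)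
  have hsU : γ (max a (b - δ / 2)) ∈ U := hball (by
    rw [Real.dist_eq, abs_sub_comm, abs_of_nonneg (by linarith)]
    linarith [le_max_right a (b - δ / 2)])
  exact ⟨γ (max a (b - δ / 2)), hsU, γ, max a (b - δ / 2), b, hsb,
    hγ.mono (Icc_subset_Icc_left (le_max_left _ _)), rfl, hγb⟩

/-- Time dual: a point of `I⁻(S)` lies in `I⁻(U)` for every open `U` containing it. O'Neill 1983,
Ch. 14, p. 403. [folklore] -/
theorem mem_chronologicalPast_of_isOpen {S U : Set M} {q : M}
    (hq : q ∈ g.chronologicalPast τ S) (hU : IsOpen U) (hqU : q ∈ U) :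
    q ∈ g.chronologicalPast τ U :=
  mem_chronologicalFuture_of_isOpen (τ := τ.reverse) hq hU hqU

end Chronology

section Exterior

variable {X : Type} [TopologicalSpace X] [ChartedSpace E3 X] [IsManifold (𝓡 3) ∞ X]
  [ConnectedSpace X] {D : InitialDataSet (𝓡 3) X}

/-- The self-determined exterior `J⁺(ι X) ∩ I⁻(U)` is monotone in the charted set `U`. [folklore] -/
theorem exteriorOf_mono (𝒟 : CauchyDevelopment D) {U U' : Set 𝒟.carrier} (h : U ⊆ U') :
    Summit.FinalStateConjecture.exteriorOf 𝒟 U ⊆ Summit.FinalStateConjecture.exteriorOf 𝒟 U' :=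
  inter_subset_inter_right _ (LorentzianMetric.chronologicalFuture_mono h)

/-- **Localisation of the exterior.** An OPEN set `S ⊆ exteriorOf 𝒟 U` which is contained in `U'`
lies in `exteriorOf 𝒟 U'`: each of its points is in `J⁺(ι X)`, and in `I⁻(S) ⊆ I⁻(U')` by
`mem_chronologicalPast_of_isOpen`. (For the chart transfer: the image of the late region of a
re-adapted hole chart is open, lies in the old exterior and in the new charted region, hence in the
new exterior — the `image_subset` clause of `IsLateChart` is formal.) [folklore] -/
theorem subset_exteriorOf_of_isOpen (𝒟 : CauchyDevelopment D) {U U' S : Set 𝒟.carrier}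
    (hS : S ⊆ Summit.FinalStateConjecture.exteriorOf 𝒟 U) (hSo : IsOpen S) (hSU' : S ⊆ U') :
    S ⊆ Summit.FinalStateConjecture.exteriorOf 𝒟 U' := fun _ hp ↦
  ⟨(hS hp).1, LorentzianMetric.chronologicalFuture_mono hSU'
    (mem_chronologicalPast_of_isOpen (hS hp).2 hSo hp)⟩

end Exterior

/-! ## §4 The excision / flat-domain clause transfers from adapted radii to Kerr–Schild radii -/

/-- A sublinear function stays sublinear after adding a constant: `(ρ(t) + K)/t → 0`. [folklore] -/
theorem tendsto_add_const_div_atTop {ρ : ℝ → ℝ} (h : Tendsto (fun t ↦ ρ t / t) atTop (𝓝 0)) (K : ℝ) :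
    Tendsto (fun t ↦ (ρ t + K) / t) atTop (𝓝 0) := by
  have h2 : Tendsto (fun t : ℝ ↦ K / t) atTop (𝓝 0) := tendsto_const_nhds.div_atTop tendsto_id
  have h3 := h.add h2
  rw [add_zero] at h3
  exact h3.congr fun t ↦ (add_div _ _ _).symm

/-- **Registered helper `excision_transfer`.** For a stationary final-state decomposition `d` and ANY
spins `aᵢ`, the excision radii `ρ'ᵢ := ρᵢ + Cᵢ` (`Cᵢ` the comparability constant of the adapted
radius of hole `i` with the Euclidean radius, `AdaptedChart.exists_abs_radius_sub_spatialNorm_le`) are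
still sublinear, and the flat domain of `d` contains the late half-space `{x⁰ > τ₀'}`, `τ₀' ≥ τ₀`,
minus the Kerr–Schild tubes `{r_{aᵢ}(Λᵢ⁻¹(x − cᵢ)) ≤ ρ'ᵢ(x⁰)}` — verbatim the two flat-domain clauses
`tendsto_excision_div`, `setOf_lt_excision_subset_flatDomain` of a `FinalStateDecomposition` with
motions `d.motion`, spins `a`, flat domain `d.toOver.flatDomain` (`A.radius ≥ ‖y‖ − Cᵢ ≥ r_{aᵢ} − Cᵢ`
in the rest frame, `Kerr.radius_le_spatialNorm`). [folklore] -/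
theorem excision_transfer : ∀ (𝓢 : Spacetime.{0} 4) (O : Set 𝓢.carrier) (k : ℕ) (d : StationaryFinalStateDecomposition 𝓢 O k) (a : Fin d.N → ℝ), ∃ ρ : Fin d.N → ℝ → ℝ, (∀ i, Filter.Tendsto (fun t ↦ ρ i t / t) Filter.atTop (nhds 0)) ∧ ∀ τ₀' : ℝ, d.toOver.τ₀ ≤ τ₀' → {x : E4 | τ₀' < x 0 ∧ ∀ i, ρ i (x 0) < Kerr.radius (a i) (poincareInv (d.motion i).1 (d.motion i).2 x)} ⊆ (d.toOver.flatDomain : Set E4) := by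
  intro 𝓢 O k d a
  choose C hC using fun i ↦ (d.adapted i).exists_abs_radius_sub_spatialNorm_le
  refine ⟨fun i t ↦ d.toOver.excision i t + C i,
    fun i ↦ tendsto_add_const_div_atTop (d.toOver.tendsto_excision_div i) _, fun τ₀' hτ x hx ↦ ?_⟩
  obtain ⟨hx0, hxi⟩ := hx
  refine d.toOver.setOf_lt_excision_subset_flatDomain ⟨lt_of_le_of_lt hτ hx0, fun i ↦ ?_⟩
  show d.toOver.excision i (x 0) < (d.adapted i).radius (poincareInv (d.motion i).1 (d.motion i).2 x)
  have h1 := (abs_le.1 (hC i (poincareInv (d.motion i).1 (d.motion i).2 x))).1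
  have h2 := Kerr.radius_le_spatialNorm (a i) (poincareInv (d.motion i).1 (d.motion i).2 x)
  have h3 : d.toOver.excision i (x 0) + C i <
      Kerr.radius (a i) (poincareInv (d.motion i).1 (d.motion i).2 x) := hxi i
  linarith

end Summit.FinalStateConjecture.FinalStateConjecture.Theorems.SymplecticDualOfTheBomb

end
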